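import Summits.ResolutionOfSingularities.ResolutionOfSingularities.Theorems.FrobeniusClosingSteerNoSingularCarrierBirational
import HarnessLib

/-!
# No singular carrier along a σ_top-steered run — part 3b: ONE-STEP PROPAGATION and the INDUCTION (N4)
# ((N4) of res-L0-w41-plan-1 RULING 7 §σ2.20 «NORMALISED START», W4.1 crux `Steer`)

W4.1, crux `Steer` (stmt-ResolutionOfSingularities-16345), §σ2.20 (res-L0-w41-plan-1 RULING 7 2026-08-27T07:54:40Z):
(N4) `noSingularCarrier_along_run`. Parts 1–2 (`…NoSingularCarrier.lean` p514035, `…NoSingularCarrierStep.lean`):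
the carrier dichotomy at a stage; divisor steps are trivial and create no new carrier; the exceptional prime of a
step along a regular centre is regular. Here (Theses-free, def-free; the bodies of `IsLocalBlowupAlong`,
`IsExcParamAlong`, `IsStrictStepAlong`, `IsSigmaTopCentre`, `NormalAt`, `NoSingularCarrier` unfolded):

(part 3a `…NoSingularCarrierBirational.lean`: `false_of_normalAt_of_carrier_off_exceptional` — from a `NormalAt` stage no
carrier of the next stage has a prime factor off the exceptional parameter, by birationality and (N5).)

* `noSingularCarrier_of_normalAt_step` — hence **`NormalAt` at `(R, s)` gives `NoSingularCarrier` at `(R', s')`**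
  across ANY steered step along a centre `P ≤ 𝔪_R` with `R ⧸ P` regular (a prime factor `q ∣ x₀` generates the
  exceptional prime `(x₀)`, regular by part 2);
* `noSingularCarrier_along_run` — **(N4)**: along a σ_top-steered run whose members are regular local rings of one
  dimension `n ≥ 2`, with field generic torsor fibres and (N5) at every member, `NormalAt` at stage `0` implies
  `NoSingularCarrier` at every stage (induction: by the dichotomy of part 1 a stage is `NormalAt` — then this part —
  or its step is a divisor step — then part 2).

OURS (the W4.1 engine; res-L0-w41-plan-1 RULING 7 (N4)/(N5); AI review weaker than expert review); nothing here is
attributed to [claim: Hironaka2017]. [cite: NovacoskiSpivakovsky2014, Def. 2.11] [cite: Matsumura1987, Thm. 20.3]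
-/

noncomputable section

-- `Summit.<S>.<S>.…` duplicates the summit name by design (single-problem summit).
set_option linter.dupNamespace false

open Polynomial IsLocalRing Literature.AlgebraicGeometry.Resolution

namespace Summit.ResolutionOfSingularities.ResolutionOfSingularities.Theorems.SwitchingDichotomy.NoSingularCarrier

variable {K : Type} [Field K]

/-! ## §3 `NormalAt` at `(R, s)` gives `NoSingularCarrier` at `(R', s')` -/

/-- A field is a regular local ring; in particular so is the residue field `R ⧸ 𝔪_R`. [folklore] -/
theorem isRegularLocalRing_quotient_maximalIdeal (A : Type*) [CommRing A] [IsLocalRing A] :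
    IsRegularLocalRing (A ⧸ maximalIdeal A) := by
  letI : Field (A ⧸ maximalIdeal A) := Ideal.Quotient.field (maximalIdeal A)
  infer_instance

/-- **`NormalAt` propagates to `NoSingularCarrier` across any steered step** (RULING 7 (N4), «at a blow-up step …
new height-one primes of `R_{i+1}` are the exceptional `x` (`R_{i+1}/x` regular) or birational to a height-one `q₀`
of `R_i`»). Let `R ⊆ K` be regular local of characteristic `p`, dominated by `O`, `P ≤ 𝔪_R` with `R ⧸ P` a regular
local ring (a σ_top-permissible centre, or the closed point), `R'` the local blowing up of `R` along `P` (regular),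
`s = x·s' + g` a strict-transform step (body of `IsStrictStepAlong O R P s s'`), `s ^ p ∈ R`, the body of
`NormalAt O R p s`, and (N5) at `R` (`hN5`). Then the body of `NoSingularCarrier O R' p s'` holds: a prime factor `q`
of a carrier either divides the exceptional parameter — then `(q) = (x₀)` has regular quotient (part 2) — or not —
impossible by `false_of_normalAt_of_carrier_off_exceptional`. OURS (W4.1 engine).
[cite: NovacoskiSpivakovsky2014, Def. 2.11] [cite: Matsumura1987, Thm. 20.3] -/
theorem noSingularCarrier_of_normalAt_step (p : ℕ) [Fact p.Prime] [CharP K p] (O : ValuationSubring K)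
    {R R' : Subring K} [IsRegularLocalRing R] [IsRegularLocalRing R']
    (hval : ∀ a : R, a ∈ maximalIdeal R ↔ O.valuation (a : K) < 1)
    {P : Ideal R} (hP : P ≤ maximalIdeal R) [IsRegularLocalRing (R ⧸ P)]
    (hbl : IsLocalBlowupAlong O R P R') {s s' : K}
    (hstep : ∃ x g : K, ((∃ hx : x ∈ R, (⟨x, hx⟩ : R) ∈ P) ∧ x ≠ 0 ∧
      ∀ y : R, y ∈ P → O.valuation (y : K) ≤ O.valuation x) ∧ g ∈ R ∧ s = x * s' + g)
    (hs : s ^ p ∈ R)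
    (hN : ∀ g h u : K, g ∈ R → h ∈ R → u ∈ R → O.valuation h < 1 → s ^ p ≠ g ^ p + h ^ p * u)
    (hN5 : ∀ π a b c : R, Prime π → ¬ π ∣ b → b ^ p * ⟨s ^ p, hs⟩ = a ^ p + π ^ p * c →
      ∃ g₀ u₀ : R, (⟨s ^ p, hs⟩ : R) = g₀ ^ p + π ^ p * u₀) :
    ∀ g h u : K, g ∈ R' → ∀ hh : h ∈ R', u ∈ R' → s' ^ p = g ^ p + h ^ p * u →
      ∀ q : R', Prime q → q ∣ (⟨h, hh⟩ : R') → IsRegularLocalRing (R' ⧸ Ideal.span {q}) := by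
  classical
  intro G H U hG hH hU heq q hq hqH
  haveI : IsDomain R' := inferInstance
  obtain ⟨x, g, ⟨⟨hxR, -⟩, -, -⟩, hg, hst⟩ := hstep
  have hRR' : R ≤ R' := hbl.isLocalBlowup.le
  -- normal form of the local blowing up: the chart of `x₀ ∈ P` of maximal value
  obtain ⟨x₀, hx₀P, hx₀0, hmax₀, hR'⟩ := SteeredRun.exists_eq_locAtCentre_of_isLocalBlowupAlong hbl
  have hx₀0K : ((x₀ : R) : K) ≠ 0 := fun h => hx₀0 (Subtype.ext h)
  by_cases hqx₀ : q ∣ (⟨(x₀ : K), hRR' x₀.2⟩ : R')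
  · -- `q` divides the exceptional parameter: `(q) = (x₀)`, regular by part 2
    obtain ⟨hx₀R', hregx₀⟩ := isRegularLocalRing_quotient_span_excParam hval hP hbl (x := ((x₀ : R) : K))
      ⟨⟨x₀.2, by simpa using hx₀P⟩, hx₀0K, hmax₀⟩
    set X : R' := ⟨(x₀ : K), hx₀R'⟩ with hXdef
    haveI : IsRegularLocalRing (R' ⧸ Ideal.span {X}) := hregx₀
    haveI hXprime : (Ideal.span {X}).IsPrime :=
      (Ideal.Quotient.isDomain_iff_prime _).mp (isDomain_of_isRegularLocalRing _)
    have hX0 : X ≠ 0 := fun h => hx₀0K (congrArg Subtype.val h)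
    have hle : Ideal.span {X} ≤ Ideal.span {q} := Ideal.span_singleton_le_span_singleton.mpr hqx₀
    have hXht : (Ideal.span {X}).height = 1 :=
      Ideal.height_span_singleton_eq_one_of_mem_nonZeroDivisors (mem_nonZeroDivisors_of_ne_zero hX0)
        (fun hu => hXprime.ne_top (Ideal.eq_top_of_isUnit_mem _ (Ideal.mem_span_singleton_self X) hu))
    have hqht : (Ideal.span {q}).height ≤ 1 := Ideal.height_span_singleton_le_one hq.not_unit
    have heqI : Ideal.span {X} = Ideal.span {q} :=
      (Ideal.span {X}).eq_of_le_of_height_le hle (hqht.trans hXht.ge)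
    rw [← heqI]
    exact hregx₀
  · exact (false_of_normalAt_of_carrier_off_exceptional p O hval x₀.2 hx₀0K hR' hRR' hxR hg hst hs hN hN5
      hG hH hU heq q hq hqH hqx₀).elim

/-! ## §4 (N4): no singular carrier along a σ_top-steered run -/

/-- Members of a steered run are their own local rings at the centre of `O` and lie in `O`. [folklore] -/
theorem le_and_locAtCentre_eq_of_run {O : ValuationSubring K} (R : ℕ → Subring K) (P : (i : ℕ) → Ideal (R i))
    (hRO : R 0 ≤ O.toSubring) (hloc : locAtCentre (R 0) O = R 0)
    (hbl : ∀ i, IsLocalBlowupAlong O (R i) (P i) (R (i + 1))) :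
    ∀ i, R i ≤ O.toSubring ∧ locAtCentre (R i) O = R i := by
  intro i
  induction i with
  | zero => exact ⟨hRO, hloc⟩
  | succ i _ =>
    exact ⟨(hbl i).isLocalBlowup.target_le, (hbl i).isLocalBlowup.locAtCentre_eq⟩

/-- Domination read on the maximal ideal: for a local `B ⊆ O` with `B_{𝔪_O ∩ B} = B`, `a ∈ 𝔪_B ↔ v(a) < 1`.
[folklore] -/
theorem mem_maximalIdeal_iff_of_locAtCentre_eq {O : ValuationSubring K} {B : Subring K} [IsLocalRing B]
    (hBO : B ≤ O.toSubring) (hloc : locAtCentre B O = B) :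
    ∀ a : B, a ∈ maximalIdeal B ↔ O.valuation (a : K) < 1 := by
  have h := subringDominates_locAtCentre hBO
  rw [hloc] at h
  exact (subringDominates_valuationSubring_iff hBO).mp h

/-- **(N4) `noSingularCarrier_along_run`** (res-L0-w41-plan-1 RULING 7 §σ2.20): along a σ_top-STEERED RUN
`(R i, P i, s i)` (body of `IsSteeredRun O R P t p s`: σ_top centres, local blowings up along them, strict transforms)
whose members are regular local rings of one dimension `n ≥ 2` (`SteeredMembersRegular`, K-T1), starting from
`R 0 = (R 0)_{centre} ⊆ O`, with field generic torsor fibres (`hirr`) and the local–global Frobenius input (N5) at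
every member (`hN5`, res-D-pv-007 BY NAME), the body of `NormalAt O (R 0) p t` implies the body of
`NoSingularCarrier O (R i) p (s i)` for EVERY `i`. Induction on `i`: at stage `0`, `NormalAt` leaves only unit
carriers; at stage `i`, the carrier dichotomy (part 1) gives `NormalAt` — then `noSingularCarrier_of_normalAt_step` —
or a divisor step `P i = (π)` — then `R (i+1) = R i` and the carriers of `s (i+1)` are carriers of `s i` (part 2).
OURS (the W4.1 engine; AI review weaker than expert review). [cite: Matsumura1987, Thm. 20.3]
[cite: NovacoskiSpivakovsky2014, Def. 2.11] -/
theorem noSingularCarrier_along_run (p : ℕ) [Fact p.Prime] [CharP K p] (O : ValuationSubring K)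
    (R : ℕ → Subring K) (P : (i : ℕ) → Ideal (R i)) (t : K) (s : ℕ → K) {n : ℕ} (hn : 2 ≤ n)
    (hreg : ∀ i, IsRegularLocalRing (R i)) (hdim : ∀ i, ringKrullDim (R i) = n)
    (hRO : R 0 ≤ O.toSubring) (hloc : locAtCentre (R 0) O = R 0)
    (hirr : ∀ i, ∀ y z : R i, (z : K) ≠ 0 → s i * z ≠ y)
    (hN5 : ∀ i, ∀ hs : s i ^ p ∈ R i, ∀ π a b c : R i, Prime π → ¬ π ∣ b →
      b ^ p * ⟨s i ^ p, hs⟩ = a ^ p + π ^ p * c → ∃ g₀ u₀ : R i, (⟨s i ^ p, hs⟩ : R i) = g₀ ^ p + π ^ p * u₀)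
    (hN : ∀ g h u : K, g ∈ R 0 → h ∈ R 0 → u ∈ R 0 → O.valuation h < 1 → t ^ p ≠ g ^ p + h ^ p * u)
    (hrun : s 0 = t ∧ ∀ i, ∃ (_ : IsLocalRing (R i)) (hs : s i ^ p ∈ R i),
      ((P i ≠ maximalIdeal (R i) ∧
        (∃ _ : (P i).IsPrime,
          ¬ IsRegularLocalRing (AdjoinRoot (Polynomial.X ^ p - Polynomial.C
              (algebraMap (R i) (Localization.AtPrime (P i)) ⟨s i ^ p, hs⟩))) ∧
          (∀ (Q : Ideal (R i)) [Q.IsPrime],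
            ¬ IsRegularLocalRing (AdjoinRoot (Polynomial.X ^ p - Polynomial.C
                (algebraMap (R i) (Localization.AtPrime Q) ⟨s i ^ p, hs⟩))) →
              Q ≤ P i → Q = P i) ∧
          (∀ (Q : Ideal (R i)) [Q.IsPrime],
            ¬ IsRegularLocalRing (AdjoinRoot (Polynomial.X ^ p - Polynomial.C
                (algebraMap (R i) (Localization.AtPrime Q) ⟨s i ^ p, hs⟩))) →
              (∀ (Q' : Ideal (R i)) [Q'.IsPrime],
                ¬ IsRegularLocalRing (AdjoinRoot (Polynomial.X ^ p - Polynomial.C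
                    (algebraMap (R i) (Localization.AtPrime Q') ⟨s i ^ p, hs⟩))) →
                  Q' ≤ Q → Q' = Q) →
              ringKrullDim (R i ⧸ Q) ≤ ringKrullDim (R i ⧸ P i))) ∧
        IsRegularLocalRing (R i ⧸ P i) ∧ ∃ g : R i, (⟨s i ^ p, hs⟩ : R i) - g ^ p ∈ P i ^ p) ∨
      (P i = maximalIdeal (R i) ∧
        (∀ Q : Ideal (R i), ¬ (Q ≠ maximalIdeal (R i) ∧
          (∃ _ : Q.IsPrime,
            ¬ IsRegularLocalRing (AdjoinRoot (Polynomial.X ^ p - Polynomial.C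
                (algebraMap (R i) (Localization.AtPrime Q) ⟨s i ^ p, hs⟩))) ∧
            (∀ (Q₁ : Ideal (R i)) [Q₁.IsPrime],
              ¬ IsRegularLocalRing (AdjoinRoot (Polynomial.X ^ p - Polynomial.C
                  (algebraMap (R i) (Localization.AtPrime Q₁) ⟨s i ^ p, hs⟩))) →
                Q₁ ≤ Q → Q₁ = Q) ∧
            (∀ (Q₁ : Ideal (R i)) [Q₁.IsPrime],
              ¬ IsRegularLocalRing (AdjoinRoot (Polynomial.X ^ p - Polynomial.C
                  (algebraMap (R i) (Localization.AtPrime Q₁) ⟨s i ^ p, hs⟩))) →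
                (∀ (Q' : Ideal (R i)) [Q'.IsPrime],
                  ¬ IsRegularLocalRing (AdjoinRoot (Polynomial.X ^ p - Polynomial.C
                      (algebraMap (R i) (Localization.AtPrime Q') ⟨s i ^ p, hs⟩))) →
                    Q' ≤ Q₁ → Q' = Q₁) →
                ringKrullDim (R i ⧸ Q₁) ≤ ringKrullDim (R i ⧸ Q))) ∧
          IsRegularLocalRing (R i ⧸ Q) ∧ ∃ g : R i, (⟨s i ^ p, hs⟩ : R i) - g ^ p ∈ Q ^ p)) ∧
        ∃ g : R i, (⟨s i ^ p, hs⟩ : R i) - g ^ p ∈ maximalIdeal (R i) ^ p)) ∧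
      IsLocalBlowupAlong O (R i) (P i) (R (i + 1)) ∧
      ∃ x g : K, ((∃ hx : x ∈ R i, (⟨x, hx⟩ : R i) ∈ P i) ∧ x ≠ 0 ∧
        ∀ y : R i, y ∈ P i → O.valuation (y : K) ≤ O.valuation x) ∧ g ∈ R i ∧
        s i = x * s (i + 1) + g) :
    ∀ i, ∀ g h u : K, g ∈ R i → ∀ hh : h ∈ R i, u ∈ R i → s i ^ p = g ^ p + h ^ p * u →
      ∀ q : R i, Prime q → q ∣ (⟨h, hh⟩ : R i) → IsRegularLocalRing (R i ⧸ Ideal.span {q}) := by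
  classical
  obtain ⟨hs0, hstep⟩ := hrun
  have hmem := le_and_locAtCentre_eq_of_run R P hRO hloc fun i => by
    obtain ⟨_, _, _, hbl, _⟩ := hstep i
    exact hbl
  have hval : ∀ i, ∀ a : R i, a ∈ maximalIdeal (R i) ↔ O.valuation (a : K) < 1 := fun i => by
    haveI := hreg i
    exact mem_maximalIdeal_iff_of_locAtCentre_eq (hmem i).1 (hmem i).2
  intro i
  induction i with
  | zero =>
    -- `NormalAt` at stage 0: a prime factor of a carrier's `h` makes `h` a non-unit, i.e. of positive value
    intro g h u hg hh hu heq q hq hqh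
    haveI := hreg 0
    exfalso
    have hhu : ¬ IsUnit (⟨h, hh⟩ : R 0) := fun hunit => hq.not_unit (isUnit_of_dvd_unit hqh hunit)
    have hvh : O.valuation h < 1 := (hval 0 ⟨h, hh⟩).mp ((IsLocalRing.mem_maximalIdeal _).mpr hhu)
    exact hN g h u hg hh hu hvh (hs0 ▸ heq)
  | succ i ih =>
    haveI := hreg i
    haveI := hreg (i + 1)
    obtain ⟨_, hs, hσ, hbl, hst⟩ := hstep i
    -- the carrier dichotomy at stage `i` (part 1)
    rcases normalAt_or_divisorCentre_of_noSingularCarrier p O (R i) (hdim i) hn (hval i) hs (hirr i) ih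
        (P i) hσ with hNi | ⟨-, -, π, hπ, hPπ⟩
    · -- `NormalAt` at stage `i`: the step along the regular centre `P i`
      have hPreg : P i ≤ maximalIdeal (R i) ∧ IsRegularLocalRing (R i ⧸ P i) := by
        rcases hσ with ⟨hne, ⟨hprime, -⟩, hregP, -⟩ | ⟨hPm, -, -⟩
        · exact ⟨IsLocalRing.le_maximalIdeal hprime.ne_top, hregP⟩
        · refine ⟨hPm.le, ?_⟩
          rw [hPm]
          exact isRegularLocalRing_quotient_maximalIdeal (R i)
      haveI := hPreg.2
      exact noSingularCarrier_of_normalAt_step p O (hval i) hPreg.1 hbl hst hs hNi (hN5 i hs)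
    · -- divisor step along `P i = (π)`: `R (i+1) = R i`, carriers of `s (i+1)` are carriers of `s i`
      have heqR : R (i + 1) = R i :=
        eq_of_isLocalBlowupAlong_span_singleton (hmem i).2 π (hPπ ▸ hbl)
      obtain ⟨x, g, ⟨⟨hx, -⟩, -, -⟩, hg, hsx⟩ := hst
      exact noSingularCarrier_of_divisorStep p heqR hx hg hsx ih

end Summit.ResolutionOfSingularities.ResolutionOfSingularities.Theorems.SwitchingDichotomy.NoSingularCarrier

end
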